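import Mathlib
import Summits.ValiantsHypothesis.ValiantsHypothesis.Theorems.NewtonUnitEquationsDissociatedUniformTotalsLawChains
import Summits.ValiantsHypothesis.ValiantsHypothesis.Theorems.NewtonUnitEquationsDissociatedUniformTotalsLawHexagon
import HarnessLib

/-!
# Crux `NewtonUnitEquations.DissociatedUniform` (stmt-ValiantsHypothesis-5905): EXCHANGE and one-sided REDUCTION lemmas for
# class tops on the cyclically-unimodal stratum (tools of the triple chain localisation `…TotalsLawTripleChains`)

Setting of `…TotalsLawChains` with THREE curves `a b c : ZMod q → ℝ²` and a weight `w` making the label sequences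
`⟨w, a·⟩, ⟨w, b·⟩, ⟨w, c·⟩` cyclically unimodal (`CycUnimodalAt _ n d`: mode `m = n + d`, descending arc `m, m+1, …` of
length `q − 1 − d`, ascending arc `…, m − 1, m` of length `d`).  For a strict `w`-top `p` of the Finset model `classFin a b c s` of
class `s`:
* `classFin_swap12 / _rotate / _swap23 / _swap13` — the class is symmetric in the three curves (from `classPts_swap/rotate`);
* `eq_of_dominates₃` — a class triple weighing at least `⟨w, p⟩` represents `p`;
* `exchange_fwd_bwd` — TWO-LETTER EXCHANGE: if `p = u(m_u + i) + v y + t(m_t − k)` with the first letter `i` steps down the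
  descending arc and the third `k` steps down the ascending arc, then moving both `r ≤ min(i,k)` steps towards their modes gives
  another representation of `p` (class preserved, weight not smaller, strictness);
* `chain_of_forward` / `chain_of_backward` — ONE-SIDED REDUCTION: three letters on the descending (resp. ascending) arcs with
  offsets `i, j, k` can be replaced by componentwise smaller offsets with `i' + j' + k' < q` (subtract the multiple `q⌊(i+j+k)/q⌋`
  greedily; the residue and hence the class is unchanged, the weight does not drop).
Honest label: bookkeeping lemmas; no law is proved here; nothing bears on VP ≠ VNP.
[folklore: exchange / domination arguments for separable objectives with unimodal summands]
-/

set_option linter.dupNamespace false -- `ValiantsHypothesis.ValiantsHypothesis` (summit = problem) in every name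

open scoped BigOperators Pointwise

namespace Summit.ValiantsHypothesis.ValiantsHypothesis.Theorems.NewtonUnitEquationsDissociatedUniform

namespace TotalsLaw

open Literature.Computability.AlgebraicComplexity.KPTT.PlanarMinkowski

section TripleExchange

variable {q : ℕ} [NeZero q]

variable (a b c : ZMod q → (Fin 2 → ℝ))

/-- The Finset model of a class is symmetric under swapping the first two curves. [folklore] -/
theorem classFin_swap12 (s : ZMod q) : classFin a b c s = classFin b a c s :=
  Finset.coe_injective (by rw [coe_classFin, coe_classFin, classPts_swap])

/-- … under the cyclic rotation of the three curves. [folklore] -/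
theorem classFin_rotate (s : ZMod q) : classFin a b c s = classFin b c a s :=
  Finset.coe_injective (by rw [coe_classFin, coe_classFin, classPts_rotate])

/-- … under swapping the last two curves. [folklore] -/
theorem classFin_swap23 (s : ZMod q) : classFin a b c s = classFin a c b s := by
  rw [classFin_rotate a b c, classFin_rotate b c a, classFin_swap12 c a b]

/-- … under swapping the first and the last curve. [folklore] -/
theorem classFin_swap13 (s : ZMod q) : classFin a b c s = classFin c b a s := by
  rw [classFin_rotate a b c, classFin_swap12 b c a]

/-- **Domination.**  A class triple weighing at least as much as the strict top IS the strict top. [folklore] -/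
theorem eq_of_dominates₃ {w : Fin 2 → ℝ} {s x y z : ZMod q} {p : Fin 2 → ℝ}
    (htop : IsStrictTop w (classFin a b c s) p) (hsum : x + y + z = s) (hval : w ⬝ᵥ p ≤ w ⬝ᵥ (a x + b y + c z)) :
    p = a x + b y + c z := by
  by_contra hne
  have := htop.lt (mem_classFin_of_sum_eq hsum) (Ne.symm hne)
  linarith

/-- **Two-letter exchange.**  If the strict top `p` of class `s` is represented with the FIRST letter `i` steps after its mode on
the descending arc and the THIRD letter `k` steps before its mode on the ascending arc, then for every `t ≤ min(i, k)` moving both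
letters `t` steps towards their modes gives another representation of `p` (the moved triple stays in the class and weighs at least
as much).  Stated for curves `(u, v, t)` in the three positions; the other position pairs follow from the symmetries of `classFin`.
[folklore] -/
theorem exchange_fwd_bwd (u v t : ZMod q → (Fin 2 → ℝ)) {w : Fin 2 → ℝ} {nu nt : ZMod q} {du dt : ℕ}
    (hu : CycUnimodalAt (fun x => w ⬝ᵥ u x) nu du) (ht : CycUnimodalAt (fun z => w ⬝ᵥ t z) nt dt)
    {s y : ZMod q} {p : Fin 2 → ℝ} (htop : IsStrictTop w (classFin u v t s) p) {i k : ℕ} (hi : du + i < q) (hk : k ≤ dt)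
    (hsum : nu + (du : ZMod q) + (i : ZMod q) + y + (nt + (dt : ZMod q) - (k : ZMod q)) = s)
    (hp : p = u (nu + (du : ZMod q) + (i : ZMod q)) + v y + t (nt + (dt : ZMod q) - (k : ZMod q))) :
    ∀ r : ℕ, r ≤ i → r ≤ k →
      p = u (nu + (du : ZMod q) + ((i - r : ℕ) : ZMod q)) + v y + t (nt + (dt : ZMod q) - ((k - r : ℕ) : ZMod q)) := by
  intro r
  induction r with
  | zero => intro _ _; simpa using hp
  | succ r ih =>
    intro hri hrk
    have hrep := ih (by omega) (by omega)
    -- the moved triple is in the class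
    have hsum' : nu + (du : ZMod q) + ((i - (r + 1) : ℕ) : ZMod q) + y +
        (nt + (dt : ZMod q) - ((k - (r + 1) : ℕ) : ZMod q)) = s := by
      rw [Nat.cast_sub hri, Nat.cast_sub hrk]
      push_cast
      linear_combination hsum
    -- and weighs at least as much as the representation at step `r`
    have h1 : w ⬝ᵥ u (nu + (du : ZMod q) + ((i - r : ℕ) : ZMod q)) ≤
        w ⬝ᵥ u (nu + (du : ZMod q) + ((i - (r + 1) : ℕ) : ZMod q)) :=
      hu.le_of_desc (i := i - r) (i' := i - (r + 1)) (by omega) (by omega)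
    have h2 : w ⬝ᵥ t (nt + (dt : ZMod q) - ((k - r : ℕ) : ZMod q)) ≤
        w ⬝ᵥ t (nt + (dt : ZMod q) - ((k - (r + 1) : ℕ) : ZMod q)) :=
      ht.le_of_asc (i := k - r) (i' := k - (r + 1)) (by omega) (by omega)
    refine eq_of_dominates₃ u v t htop hsum' ?_
    rw [hrep, dotProduct_add, dotProduct_add, dotProduct_add, dotProduct_add]
    linarith

variable {a b c}

omit [NeZero q] in
/-- A natural multiple of `q` vanishes in `ZMod q`. [folklore] -/
theorem natCast_mul_div_eq_zero (S : ℕ) : ((q * (S / q) : ℕ) : ZMod q) = 0 := by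
  push_cast
  rw [ZMod.natCast_self, zero_mul]

/-- **Forward reduction.**  A representation of the strict top with all three letters on the descending arcs after the modes
(offsets `i, j, k`, any sizes) yields one with componentwise smaller offsets summing to `< q` (offsets of total `≥ q` are dominated by
smaller offsets of the same residue). [folklore] -/
theorem chain_of_forward {w : Fin 2 → ℝ} {nα nβ nγ : ZMod q} {dα dβ dγ : ℕ}
    (hα : CycUnimodalAt (fun x => w ⬝ᵥ a x) nα dα) (hβ : CycUnimodalAt (fun y => w ⬝ᵥ b y) nβ dβ)
    (hγ : CycUnimodalAt (fun z => w ⬝ᵥ c z) nγ dγ) {s : ZMod q} {p : Fin 2 → ℝ}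
    (htop : IsStrictTop w (classFin a b c s) p) {i j k : ℕ} (hi : dα + i < q) (hj : dβ + j < q) (hk : dγ + k < q)
    (hsum : nα + (dα : ZMod q) + (i : ZMod q) + (nβ + (dβ : ZMod q) + (j : ZMod q)) + (nγ + (dγ : ZMod q) + (k : ZMod q)) = s)
    (hp : p = a (nα + (dα : ZMod q) + (i : ZMod q)) + b (nβ + (dβ : ZMod q) + (j : ZMod q)) +
      c (nγ + (dγ : ZMod q) + (k : ZMod q))) :
    ∃ i' j' k' : ℕ, dα + i' < q ∧ dβ + j' < q ∧ dγ + k' < q ∧ i' + j' + k' < q ∧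
      nα + (dα : ZMod q) + (nβ + (dβ : ZMod q)) + (nγ + (dγ : ZMod q)) + ((i' + j' + k' : ℕ) : ZMod q) = s ∧
      p = a (nα + (dα : ZMod q) + (i' : ZMod q)) + b (nβ + (dβ : ZMod q) + (j' : ZMod q)) +
        c (nγ + (dγ : ZMod q) + (k' : ZMod q)) := by
  set S := i + j + k with hS
  have hdm : q * (S / q) + S % q = S := Nat.div_add_mod S q
  have hmod : S % q < q := Nat.mod_lt _ (Nat.pos_of_ne_zero (NeZero.ne q))
  set D := q * (S / q) with hD
  have hD0 : ((D : ℕ) : ZMod q) = 0 := natCast_mul_div_eq_zero S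
  -- greedy componentwise reduction by `D` in total
  set i' := i - D with hi'
  set j' := j - (D - i) with hj'
  set k' := k - (D - i - j) with hk'
  have htot : i' + j' + k' + D = i + j + k := by omega
  have hlt : i' + j' + k' < q := by omega
  have hcast : (i' : ZMod q) + (j' : ZMod q) + (k' : ZMod q) = (i : ZMod q) + (j : ZMod q) + (k : ZMod q) := by
    have h := congrArg (fun n : ℕ => (n : ZMod q)) htot
    simp only [Nat.cast_add, hD0, add_zero] at h
    exact h
  have hsum' : nα + (dα : ZMod q) + (i' : ZMod q) + (nβ + (dβ : ZMod q) + (j' : ZMod q)) +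
      (nγ + (dγ : ZMod q) + (k' : ZMod q)) = s := by
    linear_combination hsum + hcast
  refine ⟨i', j', k', by omega, by omega, by omega, hlt, ?_, ?_⟩
  · push_cast; linear_combination hsum + hcast
  · have h1 : w ⬝ᵥ a (nα + (dα : ZMod q) + (i : ZMod q)) ≤ w ⬝ᵥ a (nα + (dα : ZMod q) + (i' : ZMod q)) :=
      hα.le_of_desc (by omega) hi
    have h2 : w ⬝ᵥ b (nβ + (dβ : ZMod q) + (j : ZMod q)) ≤ w ⬝ᵥ b (nβ + (dβ : ZMod q) + (j' : ZMod q)) :=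
      hβ.le_of_desc (by omega) hj
    have h3 : w ⬝ᵥ c (nγ + (dγ : ZMod q) + (k : ZMod q)) ≤ w ⬝ᵥ c (nγ + (dγ : ZMod q) + (k' : ZMod q)) :=
      hγ.le_of_desc (by omega) hk
    refine eq_of_dominates₃ a b c htop hsum' ?_
    rw [hp, dotProduct_add, dotProduct_add, dotProduct_add, dotProduct_add]
    linarith

/-- **Backward reduction** (mirror image of `chain_of_forward`: letters on the ascending arcs before the modes). [folklore] -/
theorem chain_of_backward {w : Fin 2 → ℝ} {nα nβ nγ : ZMod q} {dα dβ dγ : ℕ}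
    (hα : CycUnimodalAt (fun x => w ⬝ᵥ a x) nα dα) (hβ : CycUnimodalAt (fun y => w ⬝ᵥ b y) nβ dβ)
    (hγ : CycUnimodalAt (fun z => w ⬝ᵥ c z) nγ dγ) {s : ZMod q} {p : Fin 2 → ℝ}
    (htop : IsStrictTop w (classFin a b c s) p) {i j k : ℕ} (hi : i ≤ dα) (hj : j ≤ dβ) (hk : k ≤ dγ)
    (hsum : nα + (dα : ZMod q) - (i : ZMod q) + (nβ + (dβ : ZMod q) - (j : ZMod q)) + (nγ + (dγ : ZMod q) - (k : ZMod q)) = s)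
    (hp : p = a (nα + (dα : ZMod q) - (i : ZMod q)) + b (nβ + (dβ : ZMod q) - (j : ZMod q)) +
      c (nγ + (dγ : ZMod q) - (k : ZMod q))) :
    ∃ i' j' k' : ℕ, i' ≤ dα ∧ j' ≤ dβ ∧ k' ≤ dγ ∧ i' + j' + k' < q ∧
      nα + (dα : ZMod q) + (nβ + (dβ : ZMod q)) + (nγ + (dγ : ZMod q)) - ((i' + j' + k' : ℕ) : ZMod q) = s ∧
      p = a (nα + (dα : ZMod q) - (i' : ZMod q)) + b (nβ + (dβ : ZMod q) - (j' : ZMod q)) +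
        c (nγ + (dγ : ZMod q) - (k' : ZMod q)) := by
  set S := i + j + k with hS
  have hdm : q * (S / q) + S % q = S := Nat.div_add_mod S q
  have hmod : S % q < q := Nat.mod_lt _ (Nat.pos_of_ne_zero (NeZero.ne q))
  set D := q * (S / q) with hD
  have hD0 : ((D : ℕ) : ZMod q) = 0 := natCast_mul_div_eq_zero S
  set i' := i - D with hi'
  set j' := j - (D - i) with hj'
  set k' := k - (D - i - j) with hk'
  have htot : i' + j' + k' + D = i + j + k := by omega
  have hlt : i' + j' + k' < q := by omega
  have hcast : (i' : ZMod q) + (j' : ZMod q) + (k' : ZMod q) = (i : ZMod q) + (j : ZMod q) + (k : ZMod q) := by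
    have h := congrArg (fun n : ℕ => (n : ZMod q)) htot
    simp only [Nat.cast_add, hD0, add_zero] at h
    exact h
  have hsum' : nα + (dα : ZMod q) - (i' : ZMod q) + (nβ + (dβ : ZMod q) - (j' : ZMod q)) +
      (nγ + (dγ : ZMod q) - (k' : ZMod q)) = s := by
    linear_combination hsum - hcast
  refine ⟨i', j', k', by omega, by omega, by omega, hlt, ?_, ?_⟩
  · push_cast; linear_combination hsum - hcast
  · have h1 : w ⬝ᵥ a (nα + (dα : ZMod q) - (i : ZMod q)) ≤ w ⬝ᵥ a (nα + (dα : ZMod q) - (i' : ZMod q)) :=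
      hα.le_of_asc (by omega) hi
    have h2 : w ⬝ᵥ b (nβ + (dβ : ZMod q) - (j : ZMod q)) ≤ w ⬝ᵥ b (nβ + (dβ : ZMod q) - (j' : ZMod q)) :=
      hβ.le_of_asc (by omega) hj
    have h3 : w ⬝ᵥ c (nγ + (dγ : ZMod q) - (k : ZMod q)) ≤ w ⬝ᵥ c (nγ + (dγ : ZMod q) - (k' : ZMod q)) :=
      hγ.le_of_asc (by omega) hk
    refine eq_of_dominates₃ a b c htop hsum' ?_
    rw [hp, dotProduct_add, dotProduct_add, dotProduct_add, dotProduct_add]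
    linarith

end TripleExchange

end TotalsLaw

end Summit.ValiantsHypothesis.ValiantsHypothesis.Theorems.NewtonUnitEquationsDissociatedUniform
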